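import Summits.Schanuel.Schanuel.Theorems.ZilberEacDirectionalDominanceLemmas
import Summits.Schanuel.Schanuel.Theorems.ZilberEacRelationGeneral
import Summits.Schanuel.Schanuel.Theorems.ZilberEacGrowthExponent
import HarnessLib

/-!
# THEOREM J: directional dominance — density of exponential points in every dimension from
# solutions along a Zariski-dense set of lattice directions

Zilber's Exponential-Algebraic Closedness, case ladder (host summit Schanuel, cell `pub-schanuel`,
seat 2, gen 9).  The elimination behind the first Zariski-density theorems for `(s+2)`-FOLDS of the
open cells `EC(s+2, s+1)` (in particular 3-folds of `EC(3,2)`), where the surface endgames THEOREM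
G / G′ / I (two coordinates) do not reach: along ONE ray of lattice centres `x ≈ 2πi m q` every
coordinate grows like a power of `m` with pairwise COMMENSURABLE exponents except `e^{ℓ(x)}`,
`ℓ = Σ rᵢ xᵢ + c` real, whose exponent `λ = Σ rᵢ dᵢ` may be irrational — two independent exponents,
enough for surfaces only.  THEOREM J uses instead ALL rays:

* `eventually_eval_cons_ne_zero_of_directional_growth` (THEOREM J₀, one direction `v`): let
  `H ∈ ℂ[W, X₁, …, X_t]`, `H ≠ 0`, and write `H = Σ_{c,N} G_{c,N}(X) W^c` with `G_{c,N}` homogeneous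
  of degree `N` (`homogeneousComponent N` of the `W^c`-coefficient,
  `ZilberEacDirectionalDominanceLemmas`).  If every nonzero `G_{c,N}` has `G_{c,N}(v) ≠ 0`, then along
  any sequences `x_m = m v + o(m)` in `ℂ^t` and `w_m` with `log ‖w_m‖ = λ log m + O(1)`, `λ ∉ ℚ`,
  one has `H(w_m, x_m) ≠ 0` for all large `m`: the term `G_{c,N}(x_m) w_m^c` has size `m^{N + cλ}`
  up to constants, the exponents `N + cλ` are pairwise distinct, and one term dominates
  (`eventually_sum_ne_zero_of_expGrowth`).
* `eq_zero_of_directional_growth` (THEOREM J): if such sequences exist, with `H(w_m, x_m) = 0`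
  eventually, for every `v` in a set `Q` of directions on which no nonzero polynomial vanishes
  identically (e.g. lattice directions off a hypersurface, `latticeDirections_dense`), then `H = 0`
  (pick `v ∈ Q` off the zero set of the product of the nonzero `G_{c,N}`).
* `unprojectedDense_of_directional_growth` (THEOREM J, density form): `S ⊆ ℂⁿ × ℂⁿ` irreducible
  closed of dimension `≤ t + 1`; if for every direction `v ∈ Q` there are exponential points
  `p_m ∈ S ∩ Γ_exp` with `t` coordinates `= m v + O(log m)` and one more coordinate of norm
  `e^{λ log m + O(1)}`, `λ ∉ ℚ`, then `I(S ∩ Γ_exp) = I(S)` — by THEOREM H⁽ᵗ⁾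
  (`ZilberEacRelationGeneral.unprojectedDense_of_no_relation`).

HONEST FRAMING: an elimination theorem (elementary asymptotics + linear algebra of exponents); its
use is `ZilberEacRealHyperplaneDensity`; `EC(3,2)` OPEN; nothing here bears on Schanuel's conjecture
(EAC ⇏ SC).
-/

noncomputable section

open MvPolynomial Filter Topology Finset
open Literature.NumberTheory.Transcendental Literature.ModelTheory.Zilber

set_option linter.dupNamespace false

namespace Summit.Schanuel.Schanuel.Theorems

/-! ## Part C. THEOREM J₀ and THEOREM J -/

section Dominance

variable {t : ℕ}

/-- **THEOREM J₀ (one direction).**  `H ∈ ℂ[W, X₁..X_t]` nonzero, every nonzero directional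
component `G_{c,N} = homogeneousComponent N (coeff_W^c H)` non-vanishing at `v`; `x_m = m v + o(m)`,
`log ‖w_m‖ = λ log m + O(1)` with `λ` irrational.  Then `H(w_m, x_m) ≠ 0` for all large `m`. (new) -/
theorem eventually_eval_cons_ne_zero_of_directional_growth (H : MvPolynomial (Fin (t + 1)) ℂ)
    (hH : H ≠ 0) {v : Fin t → ℂ}
    (hv : ∀ c N, homogeneousComponent N ((finSuccEquiv ℂ t H).coeff c) ≠ 0 →
      eval v (homogeneousComponent N ((finSuccEquiv ℂ t H).coeff c)) ≠ 0)
    {lam : ℝ} (hlam : Irrational lam) {x : ℕ → Fin t → ℂ} {w : ℕ → ℂ}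
    (hx : ∀ ρ : ℝ, 0 < ρ → ∀ᶠ m : ℕ in atTop, ‖x m - fun i => (m : ℂ) * v i‖ ≤ ρ * m)
    (hw : ∃ E : ℝ, ∀ᶠ m : ℕ in atTop, w m ≠ 0 ∧ |Real.log ‖w m‖ - lam * Real.log m| ≤ E) :
    ∀ᶠ m : ℕ in atTop, eval (Fin.cons (w m) (x m) : Fin (t + 1) → ℂ) H ≠ 0 := by
  classical
  set P := finSuccEquiv ℂ t H with hPdef
  have hP0 : P ≠ 0 := fun h => hH ((finSuccEquiv ℂ t).injective (by rw [← hPdef, h, map_zero]))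
  -- the rectangle
  set D : ℕ := P.natDegree + 1 with hDdef
  set Nmax : ℕ := P.support.sup (fun c => (P.coeff c).totalDegree) + 1 with hNdef
  have hN : ∀ c, (P.coeff c).totalDegree < Nmax := by
    intro c
    by_cases hc : c ∈ P.support
    · exact Nat.lt_succ_of_le (Finset.le_sup (f := fun c => (P.coeff c).totalDegree) hc)
    · rw [Polynomial.notMem_support_iff.1 hc, totalDegree_zero]
      exact Nat.succ_pos _
  set R : Finset (ℕ × ℕ) := range Nmax ×ˢ range D with hR
  set G : ℕ × ℕ → MvPolynomial (Fin t) ℂ := fun p => homogeneousComponent p.1 (P.coeff p.2) with hGdef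
  set S : Finset (ℕ × ℕ) := R.filter fun p => G p ≠ 0 with hSdef
  have hSR : ∀ p ∈ S, p ∈ R ∧ G p ≠ 0 := fun p hp => Finset.mem_filter.1 hp
  -- `S` is nonempty
  have hS : S.Nonempty := by
    have hlc : P.coeff P.natDegree ≠ 0 := Polynomial.leadingCoeff_ne_zero.2 hP0
    have hsum := sum_homogeneousComponent_of_lt (P.coeff P.natDegree) (hN P.natDegree)
    obtain ⟨N, hNm, hNz⟩ : ∃ N ∈ range Nmax, homogeneousComponent N (P.coeff P.natDegree) ≠ 0 := by
      by_contra hcon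
      push Not at hcon
      exact hlc (by rw [← hsum]; exact Finset.sum_eq_zero hcon)
    refine ⟨(N, P.natDegree), Finset.mem_filter.2 ⟨?_, hNz⟩⟩
    rw [hR, Finset.mem_product]
    exact ⟨hNm, Finset.mem_range.2 (Nat.lt_succ_self _)⟩
  -- injective weights
  set ω : ℕ × ℕ → ℝ := fun p => (p.1 : ℝ) + (p.2 : ℝ) * lam with hω
  have hωinj : Set.InjOn ω S := by
    intro p _ p' _ h
    simp only [hω] at h
    by_cases h2 : p.2 = p'.2
    · have h1 : (p.1 : ℝ) = p'.1 := by rw [h2] at h; linarith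
      exact Prod.ext (by exact_mod_cast h1) h2
    · exfalso
      have hne : ((p'.2 : ℝ) - p.2) ≠ 0 := by
        rw [sub_ne_zero]
        exact fun h' => h2 (by exact_mod_cast h'.symm)
      apply hlam
      refine ⟨(((p.1 : ℤ) - p'.1 : ℤ) : ℚ) / (((p'.2 : ℤ) - p.2 : ℤ) : ℚ), ?_⟩
      push_cast
      rw [div_eq_iff hne]
      linarith
  -- log bounds for each term
  obtain ⟨Ew, hEw⟩ := hw
  have hterm : ∀ p ∈ S, ∃ E : ℝ, ∀ᶠ m : ℕ in atTop, eval (x m) (G p) ≠ 0 ∧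
      |Real.log ‖eval (x m) (G p)‖ - p.1 * Real.log m| ≤ E := by
    intro p hp
    exact eventually_log_norm_eval_homogeneous (homogeneousComponent_isHomogeneous _ _)
      (hv p.2 p.1 (hSR p hp).2) hx
  choose! E hE using hterm
  set z : ℕ → ℕ × ℕ → ℂ := fun m p => eval (x m) (G p) * w m ^ p.2 with hz
  set E' : ℝ := (∑ p ∈ S, |E p|) + (D : ℝ) * |Ew| with hE'
  have hallE : ∀ᶠ m : ℕ in atTop, ∀ p ∈ S, eval (x m) (G p) ≠ 0 ∧
      |Real.log ‖eval (x m) (G p)‖ - p.1 * Real.log m| ≤ E p :=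
    (Filter.eventually_all_finset S).2 fun p hp => hE p hp
  have hbounds : ∀ᶠ m : ℕ in atTop, ∀ p ∈ S,
      Real.exp (ω p * Real.log m - E') ≤ ‖z m p‖ ∧ ‖z m p‖ ≤ Real.exp (ω p * Real.log m + E') := by
    filter_upwards [hallE, hEw] with m hm hwm p hp
    obtain ⟨hGne, hGlog⟩ := hm p hp
    obtain ⟨hpR, -⟩ := hSR p hp
    have hc : (p.2 : ℝ) ≤ D := by
      have := (Finset.mem_range.1 (Finset.mem_product.1 hpR).2).le
      exact_mod_cast this
    have hnorm : ‖z m p‖ = Real.exp (Real.log ‖eval (x m) (G p)‖ + p.2 * Real.log ‖w m‖) := by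
      rw [Real.exp_add, Real.exp_nat_mul, Real.exp_log (norm_pos_iff.2 hGne),
        Real.exp_log (norm_pos_iff.2 hwm.1), hz]
      simp only [norm_mul, norm_pow]
    have hEp : |E p| ≤ ∑ p ∈ S, |E p| :=
      Finset.single_le_sum (f := fun p => |E p|) (fun _ _ => abs_nonneg _) hp
    have hdev : |Real.log ‖eval (x m) (G p)‖ + p.2 * Real.log ‖w m‖ - ω p * Real.log m| ≤ E' := by
      have e : Real.log ‖eval (x m) (G p)‖ + p.2 * Real.log ‖w m‖ - ω p * Real.log m =
          (Real.log ‖eval (x m) (G p)‖ - p.1 * Real.log m) +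
            p.2 * (Real.log ‖w m‖ - lam * Real.log m) := by
        simp only [hω]; ring
      rw [e]
      calc |(Real.log ‖eval (x m) (G p)‖ - p.1 * Real.log m) +
            p.2 * (Real.log ‖w m‖ - lam * Real.log m)|
          ≤ |Real.log ‖eval (x m) (G p)‖ - p.1 * Real.log m| +
              |p.2 * (Real.log ‖w m‖ - lam * Real.log m)| := abs_add_le _ _
        _ = |Real.log ‖eval (x m) (G p)‖ - p.1 * Real.log m| +
              p.2 * |Real.log ‖w m‖ - lam * Real.log m| := by rw [abs_mul, Nat.abs_cast]
        _ ≤ |E p| + D * |Ew| := by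
            have h1 : |Real.log ‖eval (x m) (G p)‖ - p.1 * Real.log m| ≤ |E p| :=
              hGlog.trans (le_abs_self _)
            have h2 : (p.2 : ℝ) * |Real.log ‖w m‖ - lam * Real.log m| ≤ D * |Ew| :=
              mul_le_mul hc (hwm.2.trans (le_abs_self _)) (abs_nonneg _) (by positivity)
            linarith
        _ ≤ E' := by rw [hE']; linarith
    rw [abs_le] at hdev
    rw [hnorm]
    exact ⟨Real.exp_le_exp.2 (by linarith [hdev.1]), Real.exp_le_exp.2 (by linarith [hdev.2])⟩
  have hT : Tendsto (fun m : ℕ => Real.log m) atTop atTop :=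
    Real.tendsto_log_atTop.comp tendsto_natCast_atTop_atTop
  have hne := eventually_sum_ne_zero_of_expGrowth S hS ω hωinj hT E' z hbounds
  filter_upwards [hne] with m hm
  -- `Σ_S z = Σ_R z = H(w_m, x_m)`
  have hSR' : ∑ p ∈ S, z m p = ∑ p ∈ R, z m p := by
    rw [hSdef]
    exact Finset.sum_filter_of_ne fun p _ hzp => by
      intro hGp
      apply hzp
      simp only [hz, hGp, map_zero, zero_mul]
  rw [eval_cons_eq_sum H (Nat.lt_succ_self _) hN, ← hR]
  rwa [hSR'] at hm

/-- **THEOREM J (all directions).**  If for every direction `v` in a set `Q ⊆ ℂ^t` on which no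
nonzero polynomial vanishes identically there are sequences `x_m = m v + o(m)`, `w_m` with
`log ‖w_m‖ = λ log m + O(1)` (`λ` irrational) and `H(w_m, x_m) = 0` for all large `m`, then `H = 0`.
(new) -/
theorem eq_zero_of_directional_growth (H : MvPolynomial (Fin (t + 1)) ℂ) {lam : ℝ}
    (hlam : Irrational lam) {Q : Set (Fin t → ℂ)}
    (hQ : ∀ G : MvPolynomial (Fin t) ℂ, G ≠ 0 → ∃ v ∈ Q, eval v G ≠ 0)
    (hseq : ∀ v ∈ Q, ∃ (x : ℕ → Fin t → ℂ) (w : ℕ → ℂ),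
      (∀ ρ : ℝ, 0 < ρ → ∀ᶠ m : ℕ in atTop, ‖x m - fun i => (m : ℂ) * v i‖ ≤ ρ * m) ∧
      (∃ E : ℝ, ∀ᶠ m : ℕ in atTop, w m ≠ 0 ∧ |Real.log ‖w m‖ - lam * Real.log m| ≤ E) ∧
      ∀ᶠ m : ℕ in atTop, eval (Fin.cons (w m) (x m) : Fin (t + 1) → ℂ) H = 0) : H = 0 := by
  classical
  by_contra hH
  set P := finSuccEquiv ℂ t H with hPdef
  set D : ℕ := P.natDegree + 1 with hDdef
  set Nmax : ℕ := P.support.sup (fun c => (P.coeff c).totalDegree) + 1 with hNdef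
  have hN : ∀ c, (P.coeff c).totalDegree < Nmax := by
    intro c
    by_cases hc : c ∈ P.support
    · exact Nat.lt_succ_of_le (Finset.le_sup (f := fun c => (P.coeff c).totalDegree) hc)
    · rw [Polynomial.notMem_support_iff.1 hc, totalDegree_zero]
      exact Nat.succ_pos _
  set R : Finset (ℕ × ℕ) := range Nmax ×ˢ range D with hR
  set G : ℕ × ℕ → MvPolynomial (Fin t) ℂ := fun p => homogeneousComponent p.1 (P.coeff p.2) with hGdef
  set S : Finset (ℕ × ℕ) := R.filter fun p => G p ≠ 0 with hSdef
  -- the product of the nonzero directional components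
  have hprod : ∏ p ∈ S, G p ≠ 0 := Finset.prod_ne_zero_iff.2 fun p hp => (Finset.mem_filter.1 hp).2
  obtain ⟨v, hvQ, hvprod⟩ := hQ _ hprod
  rw [map_prod] at hvprod
  have hv : ∀ c N, homogeneousComponent N ((finSuccEquiv ℂ t H).coeff c) ≠ 0 →
      eval v (homogeneousComponent N ((finSuccEquiv ℂ t H).coeff c)) ≠ 0 := by
    intro c N hcN
    have hmem : (N, c) ∈ S := by
      refine Finset.mem_filter.2 ⟨?_, hcN⟩
      rw [hR, Finset.mem_product, Finset.mem_range, Finset.mem_range]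
      exact ⟨(le_totalDegree_of_homogeneousComponent_coeff_ne_zero H hcN).trans_lt (hN c),
        Nat.lt_succ_of_le (le_natDegree_of_homogeneousComponent_coeff_ne_zero H hcN)⟩
    exact (Finset.prod_ne_zero_iff.1 hvprod) (N, c) hmem
  obtain ⟨x, w, hx, hw, hzero⟩ := hseq v hvQ
  have hne := eventually_eval_cons_ne_zero_of_directional_growth H hH hv hlam hx hw
  obtain ⟨m, hm1, hm2⟩ := (hne.and hzero).exists
  exact hm1 hm2

end Dominance

/-! ## Part E. THEOREM J, density form -/

section Density

variable {n t : ℕ}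

/-- Reindexing `p ∘ Fin.cons β c = Fin.cons (p β) (p ∘ c)`. [folklore] -/
theorem comp_fin_cons (p : Fin n ⊕ Fin n → ℂ) (β : Fin n ⊕ Fin n) (c : Fin t → Fin n ⊕ Fin n) :
    (fun i => p ((Fin.cons β c : Fin (t + 1) → Fin n ⊕ Fin n) i)) =
      (Fin.cons (p β) (fun i => p (c i)) : Fin (t + 1) → ℂ) := by
  funext i
  refine Fin.cases ?_ (fun j => ?_) i
  · simp
  · simp

/-- **THEOREM J (density from directional growth).**  Let `S ⊆ ℂⁿ × ℂⁿ` be irreducible closed of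
dimension `≤ t + 1`, `c₁, …, c_t` and `β` coordinates, `λ` irrational, and `Q ⊆ ℂ^t` a set of
directions on which no nonzero polynomial vanishes identically.  Suppose that for every `v ∈ Q`
there are points `p_m`, exponential points of `S` for all large `m`, with
`‖(p_m(c_i))_i - m v‖ ≤ C log m` and `|log ‖p_m(β)‖ - λ log m| ≤ E` for large `m`.  Then the
exponential points of `S` are Zariski dense: `I(S ∩ Γ_exp) = I(S)`. (new) -/
theorem unprojectedDense_of_directional_growth {S : Set (Fin n ⊕ Fin n → ℂ)}
    (hS : IsIrreducibleClosed ℂ S) (hdim : zariskiDim ℂ S ≤ ((t + 1 : ℕ) : WithBot ℕ∞))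
    (c : Fin t → Fin n ⊕ Fin n) (β : Fin n ⊕ Fin n) {lam : ℝ} (hlam : Irrational lam)
    {Q : Set (Fin t → ℂ)} (hQ : ∀ G : MvPolynomial (Fin t) ℂ, G ≠ 0 → ∃ v ∈ Q, eval v G ≠ 0)
    (hpts : ∀ v ∈ Q, ∃ p : ℕ → Fin n ⊕ Fin n → ℂ,
      (∀ᶠ m : ℕ in atTop, p m ∈ S ∧ p m ∈ expGraph ℂ n) ∧
      (∃ C : ℝ, ∀ᶠ m : ℕ in atTop, ‖(fun i => p m (c i)) - fun i => (m : ℂ) * v i‖ ≤ C * Real.log m) ∧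
      ∃ E : ℝ, ∀ᶠ m : ℕ in atTop, p m β ≠ 0 ∧ |Real.log ‖p m β‖ - lam * Real.log m| ≤ E) :
    UnprojectedDense S := by
  refine unprojectedDense_of_no_relation hS hdim (Fin.cons β c) fun H hH0 => ?_
  by_contra hcon
  push Not at hcon
  apply hH0
  refine eq_zero_of_directional_growth H hlam hQ fun v hv => ?_
  obtain ⟨p, hpS, ⟨C, hC⟩, hE⟩ := hpts v hv
  refine ⟨fun m i => p m (c i), fun m => p m β, eventually_le_mul_of_le_log hC, hE, ?_⟩
  filter_upwards [hpS] with m hm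
  rw [← comp_fin_cons]
  exact hcon (p m) hm

end Density

end Summit.Schanuel.Schanuel.Theorems

end
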